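import Summits.ABC.IUTFork.Joshi.ATS4TateDivisorLegendre
import Literature.IUT.LogVolume.SubThetaFieldUnramified
import Literature.IUT.LogVolume.ThetaFieldReadingClosure
import Literature.NumberTheory.NumberFields.UnramifiedDescentPrimeDegree
import Literature.NumberTheory.NumberFields.RelativeDifferentExponents
import HarnessLib

/-!
# [J-IV] Lemma 4.1.4 (1) DISCHARGED on the tree's Legendre / theta-field model:
# `L/L_tpd` is unramified outside `{v : p_v ∣ 2·3·5·ℓ} ∪ Supp(𝔮_{L_tpd})` and tamely ramified outside `{v : p_v ∣ 2·3·5}`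

Record file of the abc-iut cell, branch E «type Joshi's construction, test vs S» (rung LADDER-ABC:A2.E; seat abc-iut-E-t26,
slot T-26 fallback (1) «DERIVABLE rows of a landed Joshi file» on its own `Joshi/ATS4RamificationTateDivisor.lean`, node
J4:Lem4.1.4). TAKES NO SIDE on [IUTchIII] Cor. 3.12, on Joshi's claims, or on Mochizuki's reports on them; typed ≠ proved
≠ endorsed. Source: K. Joshi, *Construction of Arithmetic Teichmuller Spaces IV*, arXiv:2403.10430v2 (UNREFEREED, bib
`Joshi2024ATS4`), Lemma 4.1.4 p.38 l.32–40 of the cell render `HOME/lit/renders/Joshi-arxiv-2403.10430/` («(1) The extension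
`L/L_tpd` is unramified outside `{v ∈ V_{L_tpd} : v divides 2·3·5·ℓ} ∪ Supp(𝔮_{L_tpd})` and `L/L_tpd` is tamely ramified outside
`{v ∈ V_{L_tpd} : v divides 2·3·5}`»; printed proof: «immediate from Proposition 4.1.1»), for Joshi's `L = L_tpd(√−1, C_{L_tpd}[3·5])`
(§4.1.2 (9), p.38 l.10).

## What is proved (PROOF-ONLY; no new definition, no claim asserted)

The companion file types Lemma 4.1.4 (1) as the claim-`Prop` `TowerDatum.Lem414_1` = `UnramifiedOutside L_tpd L ({v : p_v ∣ 30ℓ}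
∪ Supp 𝔮_{L_tpd}) ∧ TamelyRamifiedOutside L_tpd L {v : p_v ∣ 30}`. Here both conjuncts are PROVED on the one model of the
situation the tree carries: `L_tpd = F_tpd`, the field of a point `λ ∈ U_X` of the `λ`-line ([IUTchIV] Cor. 2.2; tree `NFPoint` with
`P.InU`), and `L = F` any number field generated over `F_tpd` by square roots of `−1, λ, λ−1` and coordinates of `15`-torsion
points of the Legendre curve `y² = x(x−1)(x−λ)`, Galois over `F_tpd` (tree `Cor22.IsSubThetaField P F`; print's
`F_tpd(√−1, E_{F_tpd}[3·5])` qualifies via `Cor22.IsSubThetaField.of_isThetaField`, as does the cell's Galois closure `F‡`):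

* `unramifiedOutside_of_isSubThetaField` — `e(w|v) = 1` at every place `w` of `F` over a place `v` of `F_tpd` with `p_v ∤ 2·3·5·ℓ`
  that is not a bad place of `λ` (= not in `Supp(𝔮_{F_tpd})` of Joshi's Tate divisor on this model, `TateDivisorDatum.ofNFPoint`,
  companion `ATS4TateDivisorLegendre`): the tree's [IUTchIV] (D0) theorem `Cor22.ramificationIdx_subThetaField_eq_one`
  (inertia at a good place `v ∤ 30` fixes the radicals of the `v`-units `−1, λ, λ−1` and the prime-to-`v` torsion, Silverman
  VII.4.1). The factor `ℓ` of the printed exceptional set is not even needed (`unramifiedOutside_thirty_of_isSubThetaField`).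
* `tamelyRamifiedOutside_of_isSubThetaField` — `p_w ∤ e(w|v)` whenever `p_v ∤ 2·3·5`: `e(w|v) ∣ [F : F_tpd]` for a Galois extension
  (tree `ramificationIdx_dvd_finrank_of_isGalois`, Neukirch I (8.2)/(9.3)) and `[F : F_tpd] ∣ 2¹²·3²·5` (tree
  `Cor22.IsSubThetaField.finrank_dvd_bound`; print: Lemma 4.1.2 / Lemma 6.3.2–6.3.3).
* `lem414_1_of_isSubThetaField` — hence `TowerDatum.Lem414_1` HOLDS for every tower datum over `F_tpd → F → L′` whose
  `Supp(𝔮_{L_tpd})` contains the bad places of `λ` (any `ℓ`, any `L′`, whatever the opaque torsion `Prop`s).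

Glue (kernel, classical): `relRamIdx` (Mathlib `Ideal.ramificationIdx'` at `finBelow`) = Mathlib's new `Ideal.ramificationIdx`
(`relRamIdx_eq_ramificationIdx`); `n ∈ 𝔭_v ↔ p_v ∣ n` (`natCast_mem_asIdeal_iff_residueChar_dvd`). Lemma 4.1.4 (2) (`L′ = L(C[ℓ])`
over `L`) is NOT treated here (the tree's `Cor22.ramificationIdx_eq_one_of_adjoin_legendreTorsion` is its `F_tpd`-relative form;
the passage to `L′/L` needs the tower multiplicativity at the `L`-level — left to a sequel). No binding of `Cor312*`/`Thm311*` (R14).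
-/

noncomputable section

open NumberField IsDedekindDomain Finset
open Literature.IUT.LogVolume Literature.IUT.LogVolume.Cor22
open Literature.NumberTheory.DiophantineGeometry.GenEll

namespace Summit.ABC.IUTFork.Joshi.ATS4

/-! ## 1. Glue: residue characteristics and the two ramification indices -/

section Glue

variable {K E : Type*} [Field K] [NumberField K] [Field E] [NumberField E] [Algebra K E]

omit [NumberField K] in
/-- `n ∈ 𝔭_v ⟺ p_v ∣ n` for a finite place `v` and a natural number `n` (`p_v` = tree `residueChar`, the positive generator of
`𝔭_v ∩ ℤ`). [folklore] -/
theorem natCast_mem_asIdeal_iff_residueChar_dvd (v : HeightOneSpectrum (𝓞 K)) (n : ℕ) :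
    ((n : ℕ) : 𝓞 K) ∈ v.asIdeal ↔ residueChar K v ∣ n :=
  Literature.NumberTheory.NumberFields.natCast_mem_iff_absNorm_under_dvd K v.asIdeal n

omit [NumberField K] in
/-- If `p_v ∤ n` then `n ∉ 𝔭_v`. [folklore] -/
theorem natCast_not_mem_of_not_residueChar_dvd (v : HeightOneSpectrum (𝓞 K)) {n : ℕ} (h : ¬ residueChar K v ∣ n) :
    ((n : ℕ) : 𝓞 K) ∉ v.asIdeal := fun hn => h ((natCast_mem_asIdeal_iff_residueChar_dvd v n).mp hn)

omit [NumberField K] in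
/-- The relative ramification index `e_{w|v}` of §4.2 (`relRamIdx`, Mathlib's `Ideal.ramificationIdx'` at `v = w|_K`) is Mathlib's
length-based `Ideal.ramificationIdx` of `𝔭_w` over `𝓞_K`. [folklore] -/
theorem relRamIdx_eq_ramificationIdx (w : HeightOneSpectrum (𝓞 E)) :
    relRamIdx K E w = w.asIdeal.ramificationIdx (𝓞 K) := by
  haveI : w.asIdeal.IsPrime := w.isPrime
  rw [relRamIdx, Ideal.ramificationIdx'_eq_ramificationIdx (p := (finBelow K E w).asIdeal) (q := w.asIdeal)
    (finBelow K E w).ne_bot]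

/-- `e_{w|v} ∣ [E : K]` for `E/K` Galois (tree `ramificationIdx_dvd_finrank_of_isGalois`, Neukirch I (8.2)/(9.3)), in the
`relRamIdx` vocabulary. [folklore] -/
theorem relRamIdx_dvd_finrank [IsGalois K E] (w : HeightOneSpectrum (𝓞 E)) : relRamIdx K E w ∣ Module.finrank K E := by
  haveI : w.asIdeal.IsPrime := w.isPrime
  haveI : (finBelow K E w).asIdeal.IsMaximal := (finBelow K E w).isMaximal
  rw [relRamIdx_eq_ramificationIdx]
  exact Literature.NumberTheory.NumberFields.ramificationIdx_dvd_finrank_of_isGalois (finBelow K E w).asIdeal w.asIdeal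

omit [NumberField K] [NumberField E] in
/-- `n ∈ 𝔭_v ⟺ n ∈ 𝔭_w` for `w` over `v = w|_K` and `n ∈ ℕ` (cf. the tree's `Cor22.natCast_mem_finBelow_iff` on the `λ`-line).
[folklore] -/
theorem natCast_mem_finBelow_iff_mem (w : HeightOneSpectrum (𝓞 E)) (n : ℕ) :
    ((n : ℕ) : 𝓞 K) ∈ (finBelow K E w).asIdeal ↔ ((n : ℕ) : 𝓞 E) ∈ w.asIdeal := by
  change ((n : ℕ) : 𝓞 K) ∈ Ideal.comap (algebraMap (𝓞 K) (𝓞 E)) w.asIdeal ↔ _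
  rw [Ideal.mem_comap, map_natCast]

omit [NumberField K] [NumberField E] in
/-- The residue characteristic of `w` is that of the place `v = w|_K` under it (`p_w = p_v`). [folklore] -/
theorem residueChar_eq_residueChar_finBelow (w : HeightOneSpectrum (𝓞 E)) :
    residueChar E w = residueChar K (finBelow K E w) := by
  have hv : ((residueChar K (finBelow K E w) : ℕ) : 𝓞 K) ∈ (finBelow K E w).asIdeal :=
    (natCast_mem_asIdeal_iff_residueChar_dvd _ _).mpr dvd_rfl
  have hdvd : residueChar E w ∣ residueChar K (finBelow K E w) :=
    (natCast_mem_asIdeal_iff_residueChar_dvd w _).mp ((natCast_mem_finBelow_iff_mem w _).mp hv)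
  exact (Nat.prime_dvd_prime_iff_eq (residueChar_prime E w) (residueChar_prime K _)).mp hdvd

end Glue

/-! ## 2. Lemma 4.1.4 (1) on the Legendre / theta-field model -/

section Legendre

variable {P : NFPoint} {F : Type} [Field F] [NumberField F] [Algebra P.F F]

/-- **Unramified half, sharp form**: for `λ ∈ U_X(F_tpd)` and `F ⊇ F_tpd` a sub-theta field Galois over `F_tpd`, `F/F_tpd` is
unramified outside `{v : p_v ∣ 2·3·5} ∪ {bad places of λ}` — the tree's (D0) theorem `Cor22.ramificationIdx_subThetaField_eq_one`
read in the `UnramifiedOutside` vocabulary of [J-IV] Lemma 4.1.4. [cite: Mochizuki2012, IUTchIV Thm 1.10 proof Step (iii) (D0) p.26] -/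
theorem unramifiedOutside_thirty_of_isSubThetaField (hU : P.InU) (hF : IsSubThetaField P F) [IsGalois P.F F] :
    UnramifiedOutside P.F F ({v | residueChar P.F v ∣ 2 * 3 * 5} ∪ ↑(badPlaces P)) := by
  intro w hw
  simp only [Set.mem_union, Set.mem_setOf_eq, Finset.mem_coe, not_or] at hw
  have h30 : ((30 : ℕ) : 𝓞 P.F) ∉ (finBelow P.F F w).asIdeal :=
    natCast_not_mem_of_not_residueChar_dvd _ (by norm_num at hw ⊢; exact hw.1)
  rw [relRamIdx_eq_ramificationIdx]
  exact ramificationIdx_subThetaField_eq_one F hU hF w h30 hw.2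

/-- **[J-IV] Lemma 4.1.4 (1), unramified half, DISCHARGED on the model**: with the PRINTED exceptional set
`{v : p_v ∣ 2·3·5·ℓ} ∪ Supp(𝔮_{L_tpd})` for any `ℓ` and any `Supp(𝔮_{L_tpd})` containing the bad places of `λ` (monotonicity
from the sharp form; the factor `ℓ` is not needed on this model). [cite: Mochizuki2012, IUTchIV Thm 1.10 proof Step (iii) (D0) p.26] -/
theorem unramifiedOutside_of_isSubThetaField (hU : P.InU) (hF : IsSubThetaField P F) [IsGalois P.F F] (ℓ : ℕ)
    {T : Set (HeightOneSpectrum (𝓞 P.F))} (hT : ↑(badPlaces P) ⊆ T) :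
    UnramifiedOutside P.F F ({v | residueChar P.F v ∣ 2 * 3 * 5 * ℓ} ∪ T) :=
  (unramifiedOutside_thirty_of_isSubThetaField hU hF).mono
    (Set.union_subset_union (fun _ hv => Dvd.dvd.mul_right hv ℓ) hT)

/-- **[J-IV] Lemma 4.1.4 (1), tame half, DISCHARGED on the model**: `F/F_tpd` is tamely ramified outside `{v : p_v ∣ 2·3·5}` —
`e(w|v) ∣ [F : F_tpd] ∣ 2¹²·3²·5` (Galois; tree `ramificationIdx_dvd_finrank_of_isGalois` and
`Cor22.IsSubThetaField.finrank_dvd_bound` = the content of [J-IV] Lemma 4.1.2 / 6.3.2–6.3.3 on this model), so a residue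
characteristic `p_w = p_v ∉ {2, 3, 5}` cannot divide `e(w|v)`. [cite: Mochizuki2012, IUTchIV Thm 1.10 proof Step (ii) p.24] -/
theorem tamelyRamifiedOutside_of_isSubThetaField (hU : P.InU) (hF : IsSubThetaField P F) [IsGalois P.F F] :
    TamelyRamifiedOutside P.F F {v | residueChar P.F v ∣ 2 * 3 * 5} := by
  intro w hw hdvd
  have hdeg : relRamIdx P.F F w ∣ 2 ^ 12 * 3 ^ 2 * 5 :=
    (relRamIdx_dvd_finrank w).trans (hF.finrank_dvd_bound P hU)
  have hp : (residueChar P.F (finBelow P.F F w)).Prime := residueChar_prime P.F _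
  rw [residueChar_eq_residueChar_finBelow (K := P.F)] at hdvd
  apply hw
  show residueChar P.F (finBelow P.F F w) ∣ 2 * 3 * 5
  have h := hdvd.trans hdeg
  rcases (Nat.Prime.dvd_mul hp).mp h with h23 | h5
  · rcases (Nat.Prime.dvd_mul hp).mp h23 with h2 | h3
    · exact (hp.dvd_of_dvd_pow h2).trans (by norm_num)
    · exact (hp.dvd_of_dvd_pow h3).trans (by norm_num)
  · exact h5.trans (by norm_num)

/-- **[J-IV] Lemma 4.1.4 (1) HOLDS on the Legendre / theta-field model**: for every tower datum `𝓣` over `F_tpd → F → L′` (any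
`ℓ`, any `L′`, whatever its opaque torsion `Prop`s) whose `Supp(𝔮_{L_tpd})` contains the bad places of `λ`, the claim-`Prop`
`TowerDatum.Lem414_1` of `Joshi/ATS4RamificationTateDivisor.lean` is a THEOREM. [cite: Mochizuki2012, IUTchIV Thm 1.10 proof Step (iii) (D0) p.26] -/
theorem lem414_1_of_isSubThetaField (hU : P.InU) (hF : IsSubThetaField P F) [IsGalois P.F F]
    {L' : Type*} [Field L'] [NumberField L'] [Algebra F L'] (𝓣 : TowerDatum P.F F L')
    (hsupp : badPlaces P ⊆ 𝓣.suppq) : 𝓣.Lem414_1 :=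
  ⟨unramifiedOutside_of_isSubThetaField hU hF 𝓣.ell (Finset.coe_subset.mpr hsupp),
    tamelyRamifiedOutside_of_isSubThetaField hU hF⟩

/-- The support of Joshi's Tate divisor datum of `λ` away from `S` (companion `TateDivisorDatum.ofNFPoint`) consists of bad places;
with `S = ∅` it is exactly `badPlaces P`, so `lem414_1_of_isSubThetaField` applies with `Supp(𝔮_{L_tpd}) := (ofNFPoint P ∅).V`.
[folklore] -/
theorem ofNFPoint_V_subset_badPlaces (P : NFPoint) (S : Finset ℕ) :
    (TateDivisorDatum.ofNFPoint P S).V ⊆ badPlaces P := by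
  intro v hv
  exact ((TateDivisorDatum.mem_ofNFPoint_V P S v).mp hv).1

/-- `Supp(𝔮_{L_tpd})` for `S = ∅` is the set of all bad places of `λ`. [folklore] -/
theorem ofNFPoint_V_empty (P : NFPoint) : (TateDivisorDatum.ofNFPoint P ∅).V = badPlaces P := by
  ext v
  rw [TateDivisorDatum.mem_ofNFPoint_V]
  simp

/-- **Print's own field qualifies**: `F = F_tpd(√−1, E_{F_tpd}[3·5])` in the tree's sense `Cor22.IsThetaField P F` (which records
`IsGalois F_tpd F`) satisfies Lemma 4.1.4 (1) for every tower datum with `Supp(𝔮_{L_tpd}) ⊇` bad places.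
[cite: Mochizuki2012, IUTchIV Thm 1.10 p.22] -/
theorem lem414_1_of_isThetaField (hU : P.InU) (hF : IsThetaField P F)
    {L' : Type*} [Field L'] [NumberField L'] [Algebra F L'] (𝓣 : TowerDatum P.F F L')
    (hsupp : badPlaces P ⊆ 𝓣.suppq) : 𝓣.Lem414_1 :=
  haveI := hF.isGalois
  lem414_1_of_isSubThetaField hU (IsSubThetaField.of_isThetaField hF) 𝓣 hsupp

end Legendre

end Summit.ABC.IUTFork.Joshi.ATS4
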